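import Literature.NumberTheory.Automorphic.ArchBigCellSymmetry
import Literature.NumberTheory.Automorphic.RankinSelbergLocalProofs
import HarnessLib

/-!
# Reduction of the archimedean Gelfand–Kazhdan symmetry to the small cells

Topic `NumberTheory/Automorphic`; namespace `Literature.NumberTheory.Automorphic`. With the easy half
(`ArchBigCellSymmetry`) in hand, the full archimedean Gelfand–Kazhdan symmetry (GK_∞) — the hypothesis `hA`
of `multiplicity_one_gl_of_archBiWhittaker_gkInvolution_stable` — follows from the **small-cell vanishing
statement**

  (SV) an `ι`-odd bi-`ψ_∞`-quasi-invariant distribution on `GL_n(K_∞)` vanishing on all test functions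
  supported in the big cell `N w⁰ A N` is zero,

applied to `D = T - T ∘ ι` (`archBiWhittaker_gkInvolution_stable_of_smallCellVanishing`): `D` is a
distribution (`isArchDistribution_comp_compGKInvolution`: the words of invariant derivatives of `f ∘ ι` are
words of `f` composed with `ι`, `archLeftDeriv_comp_gkInvolution`, after commuting left and right derivatives,
`archLeftDeriv_archRightDeriv_comm` — symmetry of the second derivative of the smooth extension
`archExtZero f`), bi-quasi-invariant (`ψ_∞ ∘ ι = ψ_∞`), `ι`-odd, and kills the big-cell functions by the easy
half. (SV) is stated as an explicit hypothesis, not as a named fact; it is the remaining analytic input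
(Shalika 1974, §2: Bruhat's theory on the lower-dimensional cells).

Everything is proved; no named fact is introduced.

## References

* J. A. Shalika, *The multiplicity one theorem for `GL_n`*, Ann. of Math. 100 (1974), §2 [Shalika1974].
* I. M. Gelfand, D. A. Kazhdan, *Representations of the group GL(n, K) where K is a local field* (1975),
  §§3–4 [GelfandKazhdan1975].
-/

noncomputable section

open MeasureTheory Measure NumberField NumberField.mixedEmbedding IsDedekindDomain Set Filter Matrix
open scoped MatrixGroups Topology Classical ContDiff Matrix.Norms.Operator

namespace Literature.NumberTheory.Automorphic

variable {n : ℕ} {K : Type} [Field K] [NumberField K]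

-- as in `ArchGardingWhittaker`: the scoped `L∞`-operator normed ring structure on matrices is only
-- reducibly defeq to the Pi uniformity
set_option backward.isDefEq.respectTransparency false

local notation "R∞" => mixedSpace K
local notation "Mat" => Matrix (Fin n) (Fin n) (mixedSpace K)
local notation "G∞" => GL (Fin n) (mixedSpace K)

/-! ### 1. Invariant derivatives through the smooth extension; left and right derivatives commute -/

section Commute

/-- **`(R_X f)(y) = D f₀(y)[y X]`** for the smooth extension `f₀ = archExtZero f`. [folklore] -/
theorem archRightDeriv_eq_fderiv_archExtZero {f : G∞ → ℂ} (hf : IsArchTestFunction n K f) (X : Mat) (y : G∞) :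
    archRightDeriv X f y = fderiv ℝ (archExtZero f) (y : Mat) ((y : Mat) * X) := by
  unfold archRightDeriv
  have hcurve : (fun s : ℝ => f (y * expGL (s • X))) = fun s : ℝ => archExtZero f ((y * expGL (s • X) : G∞) : Mat) := by
    funext s; rw [archExtZero_coe]
  rw [hcurve]
  have hE : DifferentiableAt ℝ (archExtZero f) (y : Mat) := (hf.contDiff_archExtZero.differentiable (by simp)) _
  have h := hE.hasFDerivAt.comp_hasDerivAt_of_eq (0 : ℝ) (hasDerivAt_coe_mul_expGL y X)
    (by simp only [zero_smul, expGL_zero, mul_one])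
  exact h.deriv

/-- **`(L_X f)(y) = D f₀(y)[-X y]`.** [folklore] -/
theorem archLeftDeriv_eq_fderiv_archExtZero {f : G∞ → ℂ} (hf : IsArchTestFunction n K f) (X : Mat) (y : G∞) :
    archLeftDeriv X f y = fderiv ℝ (archExtZero f) (y : Mat) (-(X * (y : Mat))) := by
  unfold archLeftDeriv
  have hcurve : (fun s : ℝ => f ((expGL (s • X))⁻¹ * y)) = fun s : ℝ => archExtZero f (((expGL (s • X))⁻¹ * y : G∞) : Mat) := by
    funext s; rw [archExtZero_coe]
  rw [hcurve]
  have hE : DifferentiableAt ℝ (archExtZero f) (y : Mat) := (hf.contDiff_archExtZero.differentiable (by simp)) _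
  have h := hE.hasFDerivAt.comp_hasDerivAt_of_eq (0 : ℝ) (hasDerivAt_coe_expGL_inv_mul y X)
    (by simp only [zero_smul, expGL_zero, inv_one, one_mul])
  exact h.deriv

/-- The smooth extension of `R_X f` agrees near invertible points with `m ↦ D f₀(m)[m X]`. [folklore] -/
theorem archExtZero_archRightDeriv_eventuallyEq {f : G∞ → ℂ} (hf : IsArchTestFunction n K f) (X : Mat) (y : G∞) :
    archExtZero (archRightDeriv X f) =ᶠ[𝓝 (y : Mat)] fun m : Mat => fderiv ℝ (archExtZero f) m (m * X) := by
  filter_upwards [Units.isOpen.mem_nhds (Units.isUnit y)] with m hm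
  obtain ⟨u, rfl⟩ := hm
  rw [archExtZero_coe, archRightDeriv_eq_fderiv_archExtZero hf]

/-- The smooth extension of `L_X f` agrees near invertible points with `m ↦ D f₀(m)[-X m]`. [folklore] -/
theorem archExtZero_archLeftDeriv_eventuallyEq {f : G∞ → ℂ} (hf : IsArchTestFunction n K f) (X : Mat) (y : G∞) :
    archExtZero (archLeftDeriv X f) =ᶠ[𝓝 (y : Mat)] fun m : Mat => fderiv ℝ (archExtZero f) m (-(X * m)) := by
  filter_upwards [Units.isOpen.mem_nhds (Units.isUnit y)] with m hm
  obtain ⟨u, rfl⟩ := hm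
  rw [archExtZero_coe, archLeftDeriv_eq_fderiv_archExtZero hf]

/-- **Left and right invariant derivatives of a test function commute**: `L_X R_Y f = R_Y L_X f` (symmetry of
the second derivative of the smooth extension). [folklore] -/
theorem archLeftDeriv_archRightDeriv_comm {f : G∞ → ℂ} (hf : IsArchTestFunction n K f) (X Y : Mat) :
    archLeftDeriv X (archRightDeriv Y f) = archRightDeriv Y (archLeftDeriv X f) := by
  funext y
  set E : Mat → ℂ := archExtZero f with hE
  have hEs : ContDiff ℝ ∞ E := hf.contDiff_archExtZero
  have hdE : Differentiable ℝ (fderiv ℝ E) := (hEs.fderiv_right (m := ∞) (by simp)).differentiable (by simp)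
  have hsym : IsSymmSndFDerivAt ℝ E (y : Mat) :=
    hEs.contDiffAt.isSymmSndFDerivAt (by rw [minSmoothness_of_isRCLikeNormedField]; exact WithTop.coe_le_coe.2 le_top)
  -- the two linear maps `m ↦ m Y` and `m ↦ -X m`
  set RY : Mat →L[ℝ] Mat := (ContinuousLinearMap.mul ℝ Mat).flip Y with hRY
  set LX : Mat →L[ℝ] Mat := -(ContinuousLinearMap.mul ℝ Mat X) with hLX
  have hRYa : ∀ m : Mat, RY m = m * Y := fun m => rfl
  have hLXa : ∀ m : Mat, LX m = -(X * m) := fun m => by simp [hLX]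
  -- rewrite both sides through the extension
  rw [archLeftDeriv_eq_fderiv_archExtZero (hf.archRightDeriv Y), (archExtZero_archRightDeriv_eventuallyEq hf Y y).fderiv_eq,
    archRightDeriv_eq_fderiv_archExtZero (hf.archLeftDeriv X), (archExtZero_archLeftDeriv_eventuallyEq hf X y).fderiv_eq]
  have h1 : (fun m : Mat => fderiv ℝ (archExtZero f) m (m * Y)) = fun m : Mat => (fderiv ℝ E m) (RY m) := by
    funext m; rw [hRYa]
  have h2 : (fun m : Mat => fderiv ℝ (archExtZero f) m (-(X * m))) = fun m : Mat => (fderiv ℝ E m) (LX m) := by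
    funext m; rw [hLXa]
  rw [h1, h2, fderiv_clm_apply (hdE _) RY.differentiableAt, fderiv_clm_apply (hdE _) LX.differentiableAt,
    ContinuousLinearMap.fderiv, ContinuousLinearMap.fderiv]
  simp only [_root_.add_apply, ContinuousLinearMap.comp_apply, ContinuousLinearMap.flip_apply]
  rw [hRYa, hRYa, hLXa, hLXa, hsym (-(X * (y : Mat))) ((y : Mat) * Y)]
  rw [show -(X * (y : Mat)) * Y = -(X * ((y : Mat) * Y)) by rw [neg_mul, Matrix.mul_assoc], add_comm]

/-- Iterated: `L_X` commutes with every right word. [folklore] -/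
theorem archLeftDeriv_archRightWordDeriv_comm {f : G∞ → ℂ} (hf : IsArchTestFunction n K f) (X : Mat) :
    ∀ v : List Mat, archLeftDeriv X (archRightWordDeriv v f) = archRightWordDeriv v (archLeftDeriv X f)
  | [] => rfl
  | Y :: v => by
    rw [archRightWordDeriv_cons, archRightWordDeriv_cons, archLeftDeriv_archRightDeriv_comm (hf.archRightWordDeriv v) X Y,
      archLeftDeriv_archRightWordDeriv_comm hf X v]

/-- **Left words commute with right words** on test functions. [folklore] -/
theorem archLeftWordDeriv_archRightWordDeriv_comm {f : G∞ → ℂ} (hf : IsArchTestFunction n K f) (v : List Mat) :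
    ∀ u : List Mat, archLeftWordDeriv u (archRightWordDeriv v f) = archRightWordDeriv v (archLeftWordDeriv u f)
  | [] => rfl
  | X :: u => by
    rw [archLeftWordDeriv_cons, archLeftWordDeriv_cons, archLeftWordDeriv_archRightWordDeriv_comm hf v u,
      archLeftDeriv_archRightWordDeriv_comm (hf.archLeftWordDeriv u) X v]

end Commute

/-! ### 2. Invariant derivatives of `f ∘ ι` -/

section IotaWords

/-- **`ι(exp M) = exp(M♯)`.** [folklore] -/
theorem gkInvolution_expGL (M : Mat) : gkInvolution (expGL M) = expGL (weylSharp M) := by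
  apply Units.ext
  rw [coe_gkInvolution_eq_weylSharp, coe_expGL, coe_expGL, weylSharp, ← Matrix.exp_transpose]
  have h := Matrix.exp_units_conj (weylLong n R∞) (M : Mat)ᵀ
  rw [weylLong_inv] at h
  exact h.symm

omit [NumberField K] in
/-- `(s X)♯ = s X♯`. [folklore] -/
theorem weylSharp_smul_real (s : ℝ) (X : Mat) : weylSharp (s • X) = s • weylSharp X := weylSharp_smul s X

/-- **`L_X (f ∘ ι) = (R_{-X♯} f) ∘ ι`.** [folklore] -/
theorem archLeftDeriv_comp_gkInvolution (X : Mat) (f : G∞ → ℂ) (y : G∞) :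
    archLeftDeriv X (fun g => f (gkInvolution g)) y = archRightDeriv (-weylSharp X) f (gkInvolution y) := by
  unfold archLeftDeriv archRightDeriv
  congr 1
  funext s
  show f (gkInvolution ((expGL (s • X))⁻¹ * y)) = f (gkInvolution y * expGL (s • -weylSharp X))
  rw [gkInvolution_mul, gkInvolution_inv, gkInvolution_expGL, weylSharp_smul_real, smul_neg, expGL_neg]

/-- **`R_X (f ∘ ι) = (L_{-X♯} f) ∘ ι`.** [folklore] -/
theorem archRightDeriv_comp_gkInvolution (X : Mat) (f : G∞ → ℂ) (y : G∞) :
    archRightDeriv X (fun g => f (gkInvolution g)) y = archLeftDeriv (-weylSharp X) f (gkInvolution y) := by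
  unfold archLeftDeriv archRightDeriv
  congr 1
  funext s
  show f (gkInvolution (y * expGL (s • X))) = f ((expGL (s • -weylSharp X))⁻¹ * gkInvolution y)
  rw [gkInvolution_mul, gkInvolution_expGL, weylSharp_smul_real, smul_neg, expGL_neg, inv_inv]

/-- Left words of `f ∘ ι` are right words of `f`. [folklore] -/
theorem archLeftWordDeriv_comp_gkInvolution (f : G∞ → ℂ) :
    ∀ u : List Mat, archLeftWordDeriv u (fun g => f (gkInvolution g)) =
      fun y => archRightWordDeriv (u.map fun X => -weylSharp X) f (gkInvolution y)
  | [] => rfl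
  | X :: u => by
    funext y
    rw [archLeftWordDeriv_cons, archLeftWordDeriv_comp_gkInvolution f u, archLeftDeriv_comp_gkInvolution, List.map_cons,
      archRightWordDeriv_cons]

/-- Right words of `f ∘ ι` are left words of `f`. [folklore] -/
theorem archRightWordDeriv_comp_gkInvolution (f : G∞ → ℂ) :
    ∀ v : List Mat, archRightWordDeriv v (fun g => f (gkInvolution g)) =
      fun y => archLeftWordDeriv (v.map fun X => -weylSharp X) f (gkInvolution y)
  | [] => rfl
  | X :: v => by
    funext y
    rw [archRightWordDeriv_cons, archRightWordDeriv_comp_gkInvolution f v, archRightDeriv_comp_gkInvolution, List.map_cons,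
      archLeftWordDeriv_cons]

/-- **`L_u R_v (f ∘ ι) = (L_{v'} R_{u'} f) ∘ ι`** with `u' = -u♯`, `v' = -v♯` (letterwise), for test functions.
[folklore] -/
theorem archLeftWordDeriv_archRightWordDeriv_comp_gkInvolution {f : G∞ → ℂ} (hf : IsArchTestFunction n K f)
    (u v : List Mat) (y : G∞) :
    archLeftWordDeriv u (archRightWordDeriv v (fun g => f (gkInvolution g))) y =
      archLeftWordDeriv (v.map fun X => -weylSharp X) (archRightWordDeriv (u.map fun X => -weylSharp X) f) (gkInvolution y) := by
  rw [archRightWordDeriv_comp_gkInvolution f v, archLeftWordDeriv_comp_gkInvolution (archLeftWordDeriv _ f) u,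
    ← archLeftWordDeriv_archRightWordDeriv_comm hf]

end IotaWords

/-! ### 3. `T ∘ ι` is a distribution; (GK_∞) from the small-cell vanishing statement -/

section Reduction

variable (T : ↥(archTestFunctions n K) →ₗ[ℂ] ℂ)

/-- **`T ∘ (f ↦ f ∘ ι)` is a distribution when `T` is.** [folklore] -/
theorem isArchDistribution_comp_compGKInvolution (hT : IsArchDistribution n K T) :
    IsArchDistribution n K (T.comp archTestFunctions.compGKInvolution) := by
  intro κ hκ
  obtain ⟨C, 𝒮, hC, hbd⟩ := hT (gkInvolution '' κ) (hκ.image continuous_gkInvolution)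
  refine ⟨C, 𝒮.image fun p => (p.2.map fun X => -weylSharp X, p.1.map fun X => -weylSharp X), hC, ?_⟩
  intro f hfκ M hM
  rw [LinearMap.comp_apply]
  refine hbd (archTestFunctions.compGKInvolution f) ?_ M ?_
  · -- support of `f ∘ ι`
    intro y hy
    refine ⟨gkInvolution y, hfκ ?_, gkInvolution_gkInvolution y⟩
    have hsub : tsupport ((archTestFunctions.compGKInvolution f : ↥(archTestFunctions n K)) : G∞ → ℂ) ⊆
        gkInvolution ⁻¹' tsupport (f : G∞ → ℂ) := by
      refine closure_minimal (fun g hg => subset_tsupport _ hg) ((isClosed_tsupport _).preimage continuous_gkInvolution)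
    exact hsub hy
  · intro p hp g
    have hp' : (p.2.map fun X => -weylSharp X, p.1.map fun X => -weylSharp X) ∈
        𝒮.image fun p => (p.2.map fun X => -weylSharp X, p.1.map fun X => -weylSharp X) := Finset.mem_image_of_mem _ hp
    have h := hM _ hp' (gkInvolution g)
    simp only at h
    rw [show ((archTestFunctions.compGKInvolution f : ↥(archTestFunctions n K)) : G∞ → ℂ) = fun g => (f : G∞ → ℂ) (gkInvolution g)
      from rfl, archLeftWordDeriv_archRightWordDeriv_comp_gkInvolution f.2]
    exact h

/-- **(GK_∞) from the small-cell vanishing statement.** If every `ι`-odd bi-`ψ_∞`-quasi-invariant distribution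
on `GL_n(K_∞)` vanishing on the test functions supported in the big cell is zero, then every
bi-`ψ_∞`-quasi-invariant distribution is `ι`-symmetric (apply the hypothesis to `T - T ∘ ι`, which kills the
big-cell functions by `archBiWhittaker_gkInvolution_stable_of_tsupport_subset_bigCell`).
[cite: Shalika1974, §2] -/
theorem archBiWhittaker_gkInvolution_stable_of_smallCellVanishing
    (hSV : ∀ D : ↥(archTestFunctions n K) →ₗ[ℂ] ℂ, IsArchDistribution n K D →
      (∀ (u : ↥(upperUnitriangular (Fin n) (mixedSpace K))) (f : ↥(archTestFunctions n K)),
        D (archTestFunctions.leftTranslate (u : G∞) f) = archWhittakerChar n K u * D f) →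
      (∀ (u : ↥(upperUnitriangular (Fin n) (mixedSpace K))) (f : ↥(archTestFunctions n K)),
        D (archTestFunctions.rightTranslate (u : G∞) f) = (archWhittakerChar n K u)⁻¹ * D f) →
      (∀ f : ↥(archTestFunctions n K), D (archTestFunctions.compGKInvolution f) = -D f) →
      (∀ f : ↥(archTestFunctions n K), tsupport (f : G∞ → ℂ) ⊆ {g : G∞ | (g : Mat) ∈ bruhatBigCell n R∞} → D f = 0) →
      ∀ f : ↥(archTestFunctions n K), D f = 0)
    (hT : IsArchDistribution n K T)
    (hL : ∀ (u : ↥(upperUnitriangular (Fin n) (mixedSpace K))) (f : ↥(archTestFunctions n K)),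
      T (archTestFunctions.leftTranslate (u : G∞) f) = archWhittakerChar n K u * T f)
    (hR : ∀ (u : ↥(upperUnitriangular (Fin n) (mixedSpace K))) (f : ↥(archTestFunctions n K)),
      T (archTestFunctions.rightTranslate (u : G∞) f) = (archWhittakerChar n K u)⁻¹ * T f)
    (f : ↥(archTestFunctions n K)) : T (archTestFunctions.compGKInvolution f) = T f := by
  set D : ↥(archTestFunctions n K) →ₗ[ℂ] ℂ := T - T.comp archTestFunctions.compGKInvolution with hD
  -- the element `v = ι(u⁻¹) ∈ N` through which the translations pass to the other side
  set vι : ↥(upperUnitriangular (Fin n) (mixedSpace K)) → ↥(upperUnitriangular (Fin n) (mixedSpace K)) := fun u =>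
    ⟨gkInvolution ((u : G∞)⁻¹), gkInvolution_mem_upperUnitriangular (Subgroup.inv_mem _ u.2)⟩ with hvι
  have hιL : ∀ (u : ↥(upperUnitriangular (Fin n) (mixedSpace K))) (f : ↥(archTestFunctions n K)),
      archTestFunctions.compGKInvolution (archTestFunctions.leftTranslate (u : G∞) f) =
        archTestFunctions.rightTranslate (vι u : G∞) (archTestFunctions.compGKInvolution f) := by
    intro u f
    apply Subtype.ext
    funext x
    simp only [archTestFunctions.compGKInvolution_apply, archTestFunctions.leftTranslate_apply,
      archTestFunctions.rightTranslate_apply, hvι]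
    rw [gkInvolution_mul, gkInvolution_gkInvolution]
  have hιR : ∀ (u : ↥(upperUnitriangular (Fin n) (mixedSpace K))) (f : ↥(archTestFunctions n K)),
      archTestFunctions.compGKInvolution (archTestFunctions.rightTranslate (u : G∞) f) =
        archTestFunctions.leftTranslate (vι u : G∞) (archTestFunctions.compGKInvolution f) := by
    intro u f
    apply Subtype.ext
    funext x
    simp only [archTestFunctions.compGKInvolution_apply, archTestFunctions.leftTranslate_apply,
      archTestFunctions.rightTranslate_apply, hvι]
    rw [gkInvolution_mul, ← gkInvolution_inv, inv_inv, gkInvolution_gkInvolution]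
  -- `ψ(ι(u⁻¹)) = ψ(u)⁻¹`
  have hchar : ∀ u : ↥(upperUnitriangular (Fin n) (mixedSpace K)), archWhittakerChar n K (vι u) = (archWhittakerChar n K u)⁻¹ := by
    intro u
    have h1 : archWhittakerChar n K (vι u) = archWhittakerChar n K u⁻¹ := by
      rw [hvι]
      exact archWhittakerChar_gkInvolution u⁻¹
    rw [h1, archWhittakerChar_eq_cexp, archWhittakerChar_eq_cexp, superdiagSum_inv, map_neg, ← Complex.exp_neg]
    congr 1
    push_cast
    ring
  -- the hypotheses of (SV) for `D`
  have hDdist : IsArchDistribution n K D := by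
    intro κ hκ
    obtain ⟨C₁, 𝒮₁, hC₁, hb₁⟩ := hT κ hκ
    obtain ⟨C₂, 𝒮₂, hC₂, hb₂⟩ := isArchDistribution_comp_compGKInvolution T hT κ hκ
    refine ⟨C₁ + C₂, 𝒮₁ ∪ 𝒮₂, by positivity, fun f hf M hM => ?_⟩
    rw [hD, LinearMap.sub_apply]
    calc ‖T f - (T.comp archTestFunctions.compGKInvolution) f‖ ≤ ‖T f‖ + ‖(T.comp archTestFunctions.compGKInvolution) f‖ :=
          norm_sub_le _ _
      _ ≤ C₁ * M + C₂ * M := add_le_add (hb₁ f hf M fun p hp => hM p (Finset.mem_union_left _ hp))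
          (hb₂ f hf M fun p hp => hM p (Finset.mem_union_right _ hp))
      _ = (C₁ + C₂) * M := by ring
  have hDL : ∀ (u : ↥(upperUnitriangular (Fin n) (mixedSpace K))) (f : ↥(archTestFunctions n K)),
      D (archTestFunctions.leftTranslate (u : G∞) f) = archWhittakerChar n K u * D f := by
    intro u f
    simp only [hD, LinearMap.sub_apply, LinearMap.comp_apply]
    rw [hL, hιL, hR, hchar, inv_inv, mul_sub]
  have hDR : ∀ (u : ↥(upperUnitriangular (Fin n) (mixedSpace K))) (f : ↥(archTestFunctions n K)),
      D (archTestFunctions.rightTranslate (u : G∞) f) = (archWhittakerChar n K u)⁻¹ * D f := by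
    intro u f
    simp only [hD, LinearMap.sub_apply, LinearMap.comp_apply]
    rw [hR, hιR, hL, hchar, mul_sub]
  have hDodd : ∀ f : ↥(archTestFunctions n K), D (archTestFunctions.compGKInvolution f) = -D f := by
    intro f
    simp only [hD, LinearMap.sub_apply, LinearMap.comp_apply, archTestFunctions.compGKInvolution_compGKInvolution]
    ring
  have hDbig : ∀ f : ↥(archTestFunctions n K), tsupport (f : G∞ → ℂ) ⊆ {g : G∞ | (g : Mat) ∈ bruhatBigCell n R∞} → D f = 0 := by
    intro f hf
    simp only [hD, LinearMap.sub_apply, LinearMap.comp_apply]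
    rw [archBiWhittaker_gkInvolution_stable_of_tsupport_subset_bigCell T hT hL hR f hf, sub_self]
  have h0 := hSV D hDdist hDL hDR hDodd hDbig f
  simp only [hD, LinearMap.sub_apply, LinearMap.comp_apply] at h0
  linear_combination -h0

end Reduction

end Literature.NumberTheory.Automorphic
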